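import Summits.Ventures.DiscreteObjects.Hadamard.Order2pNegaParity
import Summits.Ventures.DiscreteObjects.Hadamard.HadamardOrbitCounts668
import Summits.Ventures.DiscreteObjects.Hadamard.ParityPermModuleFixed

/-!
# H(668), order 14 with fixed-point-free 7th power: exactly 42, 44 or 46 cycles of length 14 (kernel)

Framing: lottery ticket; floor = certified bounds/negative ranges.

Cell pub-namedobj (venture DiscreteObjects), target (H), hadamard gen 15.  Combination of the mod-167 code parity
(`hadamard668_aut_order14_fpf`: `28 ∣ #{j : κ² j ≠ j}`, gen 15) with the order-7 orbit window of gen 8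
(`hadamard668_signedAut_colClasses_window`: an automorphism of order `7` of an H(668) has between `84` and `94` cycles of
length `7`), applied to `g²`: **`hadamard668_aut_order14_fpf_window`** — for a signed automorphism `(π, κ, d, e)` of a
Hadamard matrix of order `668` with `π¹⁴ = κ¹⁴ = 1`, `π⁷`, `κ⁷` fixed-point-free and `(π², κ²) ≠ (1, 1)`, the number of
columns moved by `κ²` is `588`, `616` or `644`, i.e. `κ` has exactly `42`, `44` or `46` cycles of length `14` (and `40`, `26`
or `12` two-cycles); the same on rows.  STRUCTURE, not an exclusion.  Ours; no `sorry`.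
-/

open Polynomial Finset BigOperators Matrix

namespace Summit.Ventures.DiscreteObjects.Hadamard

open Literature.Combinatorics.Designs.GoethalsSeidel (IsHadamardMatrix)

variable {ι : Type*} [Fintype ι] [DecidableEq ι]

/-- **H(668), order 14, `g⁷` fixed-point-free: `#{j : κ² j ≠ j} ∈ {588, 616, 644}` and the same for `π`** — `42`, `44` or `46`
cycles of length `14` on rows and on columns. -/
theorem hadamard668_aut_order14_fpf_window {H : Matrix ι ι ℤ} (hH : IsHadamardMatrix H) (hι : Fintype.card ι = 668)
    {π κ : Equiv.Perm ι} {d e : ι → ℤ} (haut : IsSignedAut H π κ d e)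
    (hπ : ∀ i, (π ^ 14) i = i) (hκ : ∀ j, (κ ^ 14) j = j) (hπf : ∀ i, (π ^ 7) i ≠ i) (hκf : ∀ j, (κ ^ 7) j ≠ j)
    (hne : π ^ 2 ≠ 1 ∨ κ ^ 2 ≠ 1) :
    ((univ.filter (fun i => (π ^ 2) i ≠ i)).card = 588 ∨ (univ.filter (fun i => (π ^ 2) i ≠ i)).card = 616 ∨
      (univ.filter (fun i => (π ^ 2) i ≠ i)).card = 644) ∧
    ((univ.filter (fun j => (κ ^ 2) j ≠ j)).card = 588 ∨ (univ.filter (fun j => (κ ^ 2) j ≠ j)).card = 616 ∨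
      (univ.filter (fun j => (κ ^ 2) j ≠ j)).card = 644) := by
  obtain ⟨h28π, h28κ⟩ := hadamard668_aut_order14_fpf hH hι haut hπ hκ hπf hκf
  have haut2 := isSignedAut_pow_prod haut 2
  have hπ7 : (π ^ 2) ^ 7 = 1 := by
    ext i
    rw [← pow_mul, Equiv.Perm.coe_one, id]
    exact hπ i
  have hκ7 : (κ ^ 2) ^ 7 = 1 := by
    ext j
    rw [← pow_mul, Equiv.Perm.coe_one, id]
    exact hκ j
  have h7 : (7 : ℕ) = 3 ∨ (7 : ℕ) = 5 ∨ (7 : ℕ) = 7 ∨ (7 : ℕ) = 11 := Or.inr (Or.inr (Or.inl rfl))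
  obtain ⟨-, -, -, hwc, -⟩ := hadamard668_signedAut_colClasses_window hH hι h7 (π ^ 2) (κ ^ 2) _ _ haut2 hπ7 hκ7 hne
  obtain ⟨-, -, -, hwr, -⟩ := hadamard668_signedAut_rowClasses_window hH hι h7 (π ^ 2) (κ ^ 2) _ _ haut2 hπ7 hκ7 hne
  obtain ⟨hclo, hchi⟩ := hwc rfl
  obtain ⟨hrlo, hrhi⟩ := hwr rfl
  have hcntκ : (univ.filter (fun j => (κ ^ 2) j ≠ j)).card = (blockClasses (κ ^ 2) 7).card * 7 := by
    rw [← card_moved_eq (κ ^ 2) (by norm_num : (7 : ℕ).Prime) hκ7, Fintype.card_subtype]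
  have hcntπ : (univ.filter (fun i => (π ^ 2) i ≠ i)).card = (blockClasses (π ^ 2) 7).card * 7 := by
    rw [← card_moved_eq (π ^ 2) (by norm_num : (7 : ℕ).Prime) hπ7, Fintype.card_subtype]
  rw [hcntκ] at h28κ ⊢
  rw [hcntπ] at h28π ⊢
  constructor <;> omega

end Summit.Ventures.DiscreteObjects.Hadamard
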